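import Literature.NumberTheory.Sieve.PolymathBoundedGaps
import HarnessLib

/-!
# Polymath 8b under the generalised Elliott–Halberstam conjecture: `GEH ⟹ DHL[3,2]` and `H₁ ≤ 6`

Trunk AntSieve, companion to `PolymathBoundedGaps.lean` (unconditional `DHL[50,2]`, `H₁ ≤ 246`).
D. H. J. Polymath, *Variants of the Selberg sieve, and bounded intervals containing many primes*,
Res. Math. Sci. 1:12 (2014) = arXiv:1407.4897 (held text; page numbers are arXiv pages).

* `weakDHL_three_two_of_GEH` — NAMED FACT (D-0014), **Theorem 3.2(xii)** (p. 8, verbatim): "Assume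
  the generalized Elliott-Halberstam conjecture `GEH[ϑ]` for all `0 < ϑ < 1`. Then (xii) `DHL[3,2]`."
  In print it is "an immediate consequence of Theorem 3.14" (going beyond the `ε`-enlargement: `F`
  supported on `(k/(k−1))·R_k` with vanishing marginals, which needs `GEH[ϑ]` for ONE fixed
  `ϑ < 1` with `(Σᵢ J_{i,1−ε}(F))/I(F) > 2m/ϑ`, proved in §6 from the `GEH` sieve asymptotic
  Thm 3.6(ii)) "and the following numerical fact" **Theorem 3.15** (`k = 3`, `ε = 1/4`, a symmetric
  piecewise polynomial cutoff on `(3/2)·R₃` with ratio `> 2`, §8). Both tree notions exist: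
  `GeneralizedElliottHalberstam ϑ` (`LevelOfDistribution.lean`, Claim 2.6 shape) and
  `WeakDicksonHardyLittlewood 3 2` (`PolymathBoundedGaps.lean`, Claim 3.1 shape).
* `frequently_nth_prime_succ_le_add_six_of_GEH` — PROVED corollary, **Theorem 1.4(xii)**
  (`H₁ ≤ 6` under `GEH`): from the fact and `H(3) = 6` (Thm 3.3(xii)), via the proved
  `WeakDicksonHardyLittlewood.frequently_nth_prime_add_le` and the admissible triple `{0, 2, 6}`.

## Rendering

The hypothesis is literally "`GEH[ϑ]` for all `0 < ϑ < 1`": `∀ ϑ, 0 < ϑ → ϑ < 1 → GEH ϑ` (the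
printed proof uses one `ϑ` close enough to `1`; we keep the printed hypothesis). No decomposition
into Thm 3.14 + Thm 3.15 is vendored (one fact, not three; the route consumer needs only (xii)).

## References

* [Polymath8b2014] D. H. J. Polymath, Res. Math. Sci. 1 (2014), Art. 12 = arXiv:1407.4897:
  Thm 3.2(xii), Thm 3.3(xii) (`H(3) = 6`), Thm 1.4(xii), Thms 3.14–3.15 (pp. 8, 11).
-/

noncomputable section

open Filter Finset

namespace Literature.NumberTheory.Sieve

/-! ### The named fact: Theorem 3.2(xii) -/

/-- **Polymath 8b, Theorem 3.2(xii).** "Assume the generalized Elliott-Halberstam conjecture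
`GEH[ϑ]` for all `0 < ϑ < 1`. Then `DHL[3,2]`" — every admissible `3`-tuple has infinitely many
translates containing at least two primes. (Proof in print: Thm 3.14, sieving beyond the
`ε`-enlarged simplex under `GEH[ϑ]` for a fixed `ϑ < 1`, §6, plus the `k = 3` cutoff of Thm 3.15,
§8.) A deep conditional theorem, NOT proved here. [cite: Polymath8b2014, Theorem 3.2(xii)] -/
def weakDHL_three_two_of_GEH : Prop :=
  (∀ ϑ : ℝ, 0 < ϑ → ϑ < 1 → GeneralizedElliottHalberstam ϑ) → WeakDicksonHardyLittlewood 3 2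

/-- Unfolding lemma. [cite: Polymath8b2014, Theorem 3.2(xii)] -/
theorem weakDHL_three_two_of_GEH_iff :
    weakDHL_three_two_of_GEH ↔
      ((∀ ϑ : ℝ, 0 < ϑ → ϑ < 1 → GeneralizedElliottHalberstam ϑ) →
        WeakDicksonHardyLittlewood 3 2) :=
  Iff.rfl

/-! ### `H(3) = 6`: the admissible triple `{0, 2, 6}` -/

/-- The admissible `3`-tuple `{0, 2, 6}` of diameter `6 = H(3)` (Polymath 8b, Thm 3.3(xii):
"`H(3) = 6`"; p. 8: "thus for instance `H(3) = 6`"). [cite: Polymath8b2014, Theorem 3.3(xii)] -/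
def narrowTuple3 : Finset ℤ :=
  {0, 2, 6}

/-- `narrowTuple3` has `3` elements. [cite: Polymath8b2014, Theorem 3.3(xii)] -/
theorem card_narrowTuple3 : narrowTuple3.card = 3 := by
  decide +kernel

/-- `narrowTuple3 ⊆ [0, 6]`. [cite: Polymath8b2014, Theorem 3.3(xii)] -/
theorem narrowTuple3_mem_Icc : ∀ h ∈ narrowTuple3, (0 : ℤ) ≤ h ∧ h ≤ 6 := by
  decide +kernel

/-- For `p ∈ {2, 3}` the tuple `{0, 2, 6}` misses a residue class mod `p` (it misses `1 (2)` and
`1 (3)`). [cite: Polymath8b2014, §10.2.1] -/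
theorem narrowTuple3_exists_forall_not_dvd :
    ∀ p ∈ Finset.Icc 2 3, ∃ r ∈ Finset.range p, ∀ h ∈ narrowTuple3, ¬((p : ℤ) ∣ h - r) := by
  decide +kernel

/-- **`{0, 2, 6}` is admissible** (so `H(3) ≤ 6`; Polymath 8b, Thm 3.3(xii)). Only primes `p ≤ 3`
need checking (`isAdmissibleTuple_iff_of_le_card`). [cite: Polymath8b2014, Theorem 3.3(xii)] -/
theorem isAdmissibleTuple_narrowTuple3 : IsAdmissibleTuple narrowTuple3 := by
  rw [isAdmissibleTuple_iff_of_le_card, card_narrowTuple3]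
  intro p hp hle
  obtain ⟨r, -, hr⟩ := narrowTuple3_exists_forall_not_dvd p (Finset.mem_Icc.2 ⟨hp.two_le, hle⟩)
  exact tupleResidueCount_lt_of_forall_not_dvd hp.pos hr

/-! ### Theorem 1.4(xii): `H₁ ≤ 6` under `GEH` -/

/-- **Polymath 8b, Theorem 1.4(xii)** (`H₁ ≤ 6` under `GEH`), from the fact: if `GEH[ϑ]` holds for
all `0 < ϑ < 1` then `p_{n+1} ≤ p_n + 6` for infinitely many `n` ("`DHL[k, m+1]` implies
`H_m ≤ H(k)`", p. 8, with `H(3) = 6`). [cite: Polymath8b2014, Theorem 1.4(xii) (via Theorem 3.2(xii) and Theorem 3.3(xii))] -/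
theorem frequently_nth_prime_succ_le_add_six_of_GEH (h : weakDHL_three_two_of_GEH)
    (hGEH : ∀ ϑ : ℝ, 0 < ϑ → ϑ < 1 → GeneralizedElliottHalberstam ϑ) :
    ∃ᶠ n in atTop, Nat.nth Nat.Prime (n + 1) ≤ Nat.nth Nat.Prime n + 6 :=
  (h hGEH).frequently_nth_prime_add_le (m := 1) isAdmissibleTuple_narrowTuple3 card_narrowTuple3
    (d := 6) fun a ha b hb => by
      have h1 := narrowTuple3_mem_Icc a ha
      have h2 := narrowTuple3_mem_Icc b hb
      push_cast
      omega

end Literature.NumberTheory.Sieve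

end
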